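import Summits.HodgeConjecture.HodgeConjecture.Theorems.Ring2AbelianAllSpreadFloorHazama
import Summits.HodgeConjecture.HodgeConjecture.Theorems.Ring2BindersAbelianSchemeVHCPrimitiveMiddleLift
import Summits.HodgeConjecture.HodgeConjecture.Theorems.Ring2HypothesesDescentMotivatedExteriorSumHardLefschetz
import Literature.AlgebraicGeometry.HodgeTheory.PolarizationClassExistence
import Literature.AlgebraicGeometry.HodgeTheory.MotivatedClassesTransport
import Literature.AlgebraicGeometry.HodgeTheory.IsoTransport
import Literature.AlgebraicGeometry.Motives.AbelianVarietyExistence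
import Literature.AlgebraicGeometry.Motives.AbelianVarietyProductDimProofs
import HarnessLib

/-!
# Ring 2 · AbelianAll · SPREADING axis, part XXVIII — `HC_AV` is the Hodge conjecture for Lefschetz-PRIMITIVE classes in the
# MIDDLE degree of even-dimensional abelian varieties (the INTERSECTION of part XV's two normal forms), by defect induction
# over ring2-b02's primitive one-step lift; and the anchored floor read on that binder WITHOUT a new node

research route, not a corollary; conditional on HC_CM plus one named minimal statement.
(Cell line: research route conditional on HC_CM; not a corollary; Q11.4-sentence-2 already refuted in dim ≥ 3.)

Seat `pub-hodge-ring2-ab-spread-1` (SPREADING), generation 32. Nothing in this file is a case of the Hodge conjecture.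
`HC_CM` = `Theses.RankFourFaces.CMAbelianHodge` and `HC_AV` = `Theses.PadicSemiregularLift.HodgeAbelianVarieties` occur ONLY
as explicit hypotheses / sides of equivalences; the item `Theses.RankFourFaces.CMToAbelian` (stmt-HodgeConjecture-16267) stays
OPEN. NO new node, NO `def`, NO named fact in §§1–3 and §5 (closures = the three standard axioms); §4 displays the two records
`hF` (Deligne 1982) and `h83` (Hazama 2003) as hypotheses, exactly as part XXVII does. No sorry.

## Why this file

Part XV gave two fact-free normal forms of `HC_AV` and said so honestly: a counterexample to `HC_AV`, if any, can be taken
(a) in the MIDDLE degree `H^{2m}` of an abelian variety of dimension `2m ≥ 4` (`HC_AV_iff_forall_middleDegree`, products with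
an elliptic curve, [BFNP, Lemma 48]), or (b) Lefschetz-PRIMITIVE of degree `2p`, `2 ≤ p`, `2p ≤ dim A`, on an even-dimensional
abelian variety (`HC_AV_iff_forall_even_mem_primitiveClasses`, part XIV's single-variety Lefschetz reduction) — but NOT both
at once: the Lefschetz components of a middle-degree class live in LOWER degrees, and the product trick of (a) does not preserve
primitivity. Ring2-b02 (generation 36, `Ring2BindersAbelianSchemeVHCPrimitiveMiddleLift`, count once THEIRS) closed exactly
this gap inside the class of abelian varieties: for `c ∈ P^{2p}(X, η)` of defect `r + 1` (`dim X = 2p + r + 1`) and an elliptic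
curve `E` with a polarisation class `K_E`, the `𝔰𝔩₂`-corrected lift `z = L_{pr₁^*η} pr₁^*c − (r+1)·L_{pr₂^*K_E} pr₁^*c` on
`X × E` is PRIMITIVE for `θ = pr₁^*η + pr₂^*K_E` (defect `r`), rational and `(p+1,p+1)` with `c`, and — for `X` isomorphic to
an abelian variety — `z` algebraic forces `c` algebraic (slice + Lieberman's `A(X)`); they derived the abelian-SCHEME `VHC`
binder from it and left the single-variety statement to this seat (cell INBOX, ring2-b02 g36 closing line).

## What is proved (fact-free unless marked)

§1 `mem_algebraicClasses_of_mem_primitiveClasses_of_forall_primitiveMiddle` — DEFECT INDUCTION: if every rational `(m,m)`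
   θ-primitive class in the middle degree `H^{2m}` of every abelian variety `B` of dimension `2m ≥ 4`, for every polarisation
   class `θ` of `B`, is algebraic, then every rational `(p,p)` η-primitive class (`2 ≤ p`, `2p + d = n`, any polarisation
   class `η`) on any smooth projective `X ≅ A`, `A` abelian of dimension `n`, is algebraic — by induction on the defect `d`, one
   b02-lift per step (`A × E` is again an abelian variety, `AbelianVariety.prod`; `θ` is a polarisation class by ring2-b05's
   `isPolarizationClass_boxSum`, count once THEIRS).
§2 `HC_AV_iff_forall_primitiveMiddle` — **`HC_AV ↔` every rational `(m,m)` Λ-PRIMITIVE class in the MIDDLE degree `H^{2m}` of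
   every complex abelian variety of dimension `2m ≥ 4`, for every hard Lefschetz datum `Λ`, is algebraic**; the
   polarisation-class phrasing `HC_AV_iff_forall_isPolarizationClass_primitiveMiddle`; and
   `not_HC_AV_iff_exists_primitiveMiddle_not_mem` (a counterexample to `HC_AV`, if any, can be taken PRIMITIVE AND in the
   MIDDLE degree of an even-dimensional abelian variety of dimension `≥ 4`). This is the intersection of part XV's binders
   (a) ∩ (b); the STRENGTH is unchanged (`↔ HC_AV`), the BINDER is the smallest this axis has typed. First instance:
   `dim A = 4`, `m = 2`, `c ∈ P⁴(A) = ker(L_η : H⁴ → H⁶)`.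
§3 THE ANCHORED FLOOR READ ON THIS BINDER, WITHOUT A NODE. The display-only shape `F_CM⦃prim,mid⦄` (a `local notation3`, NO
   `def`, census-invisible by design — the standing cell rule "no further floor node" is honoured) is part XXIV's node
   `F_CM^mid` (`MiddleHodgeFailureSpreadsToCMFibre`, N104 — the least typed node of record) with its binder further restricted
   to Λ-primitive classes. Rows: `F_CM^mid → F_CM⦃prim,mid⦄` (forget primitivity; hence from `F_CM`, `F_CM^prim`,
   `F_CM^{prim,ev}`, and from the Hodge conjecture); closing `HC_CM → F_CM⦃prim,mid⦄ → HC_AV` (by §2; `hCM` consumed once,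
   through part VII's `forall_cmLocus_mem_algebraicClasses_of_HC_CM_of_isCMAnchoredDatumFor`); on-path
   `HC_AV → F_CM⦃prim,mid⦄`; exactness `HC_AV ↔ HC_CM ∧ F_CM⦃prim,mid⦄`; `ModCM F_CM⦃prim,mid⦄ ↔ CMToAbelian`; under `HC_CM`
   alone `F_CM⦃prim,mid⦄ ↔ F_CM^mid ↔ HC_AV`.
§4 MODULO PRINT (`hF ∧ h83` displayed, part XXVII's deflation verbatim): `F_CM⦃prim,mid⦄ ↔ CMToAbelian ↔ F_CM^mid` — the
   primitive-middle reading adds NOTHING modulo the two records either; it is recorded for exactly what it is: the smallest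
   BINDER, not a smaller STATEMENT.

## Honesty

* OPEN, `HC_CM`-free: the converse `F_CM⦃prim,mid⦄ → F_CM^mid`. The b02-lift moves a primitive failure of LOWER degree on `A`
  to a primitive MIDDLE failure on `A × E^d`, but an anchored datum for `(A × E^d, z)` is not an anchored datum for `(A, c)`
  (its fibres deform `A × E^d`, not `A`), and pull-backs preserve degrees (part XXIV header): no transport of parts XVII/XXII
  applies.
* NOT claimed: that `F_CM⦃prim,mid⦄` is strictly weaker than `F_CM^mid`, or "minimal" for anything (F-ab-4); `B_min` of record
  stays `F_CM^mid` (N104); the census gains NO node from this file.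
* COUNT ONCE: the one-step lift, its primitivity / rationality / Hodge type and the descent of algebraicity are ring2-b02's
  (`Ring2BindersAbelianSchemeVHCPrimitiveMiddleLift`); `isPolarizationClass_boxSum` is ring2-b05's; the Lefschetz
  single-variety reduction is part XIV's; this file contributes the induction, the `HC_AV`-level equivalence and the floor
  reading.
* PRINT: the reduction of the Hodge conjecture to primitive middle-degree classes is classical for ALL smooth projective
  varieties (hyperplane sections and `X × ℙʳ`, which LEAVE the class of abelian varieties) and is the setting of the
  Griffiths–Green / BFNP singularities programme [Kerr–Pearlstein 2011, §3.3 Conj. 41]; the middle-degree reduction INSIDE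
  abelian varieties is [BFNP 2009, Lemma 48]; for the primitive-AND-middle reduction inside abelian varieties no print locator
  was found (corpus fts+vec and galaxy both return only the Kerr–Pearlstein chapter, Friedman et al. (eds.) 2011,
  pp. 322–323) — it rests on b02's tree lemma, not on a citation.
-/

open CategoryTheory AlgebraicGeometry MonoidalCategory CartesianMonoidalCategory
open Literature.AlgebraicGeometry Literature.AlgebraicGeometry.Motives
open Literature.AlgebraicGeometry.HodgeTheory
open Literature.AlgebraicTopology.SingularHomology
open Literature.AlgebraicGeometry.Deligne1982 (deligne1982_cmDenseMumfordTateFamilies)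
open Literature.Geometry.Kaehler (lefschetzOperator)

set_option linter.dupNamespace false

namespace Summit.HodgeConjecture.HodgeConjecture.Ring2.AbelianAll

open Summit.HodgeConjecture.HodgeConjecture
open Summit.HodgeConjecture.HodgeConjecture.Theorems
open Summit.HodgeConjecture.HodgeConjecture.Theses
open Summit.HodgeConjecture.HodgeConjecture.Theses.RankFourFaces (CMAbelianHodge CMToAbelian)
open Summit.HodgeConjecture.HodgeConjecture.Theses.PadicSemiregularLift (HodgeAbelianVarieties)
open Summit.HodgeConjecture.HodgeConjecture.Ring2.Deform (cmLocus)
open Summit.HodgeConjecture.HodgeConjecture.Ring2.Binders (map_mem_primitiveClasses primitiveLift_mem_primitiveClasses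
  isRationalClass_primitiveLift isOfHodgeType_primitiveLift mem_algebraicClasses_of_primitiveLift_mem)

/-! ## §1 Defect induction over ring2-b02's primitive one-step lift (fact-free, `HC_CM`-free) -/

/-- **DEFECT INDUCTION.** Suppose that on every complex abelian variety `B` of dimension `2m ≥ 4` and for every polarisation
class `θ` of `B`, every rational `(m,m)` class in `P^{2m}(B, θ)` (primitive, MIDDLE degree) is algebraic. Then for every `d`,
every smooth projective `X` of dimension `n` isomorphic to an abelian variety, every polarisation class `η` of `X` and every
`p ≥ 2` with `2p + d = n`, every rational `(p,p)` class in `P^{2p}(X, η)` is algebraic. Induction on the defect `d`: for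
`d = 0` transport along `A ≅ X`; for `d = r + 1` apply ring2-b02's lift on `X × E` (`E` an elliptic curve with a polarisation
class `K_E`; `X × E ≅ A × E` is again an abelian variety, of dimension `n + 1`; `pr₁^*η + pr₂^*K_E` is a polarisation class),
which is primitive of defect `r`, rational and `(p+1,p+1)`, hence algebraic by the induction hypothesis, and descend
(`mem_algebraicClasses_of_primitiveLift_mem`: slice and Lieberman's `A(X)`).
[cite: VoisinHodgeI2002, §6.2.3 Def. 6.24, Cor. 6.26 and Rem. 6.27] [cite: Kleiman1968AlgebraicCycles, §1.4 and Thm. 2A11]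
[cite: Lieberman1968, main theorem] [cite: BrosnanFangNiePearlstein2009, §6 Lemma 48] -/
theorem mem_algebraicClasses_of_mem_primitiveClasses_of_forall_primitiveMiddle
    (hpm : ∀ (B : AbelianVariety ℂ) (m : ℕ), 2 ≤ m → B.dim = 2 * m →
      ∀ (θ : complexBetti B.X 2), IsPolarizationClass B.dim B.X θ →
        ∀ z : complexBetti B.X (2 * m), IsRationalClass z → IsOfHodgeType B.dim B.X (2 * m) m m z →
          z ∈ primitiveClasses θ B.dim (2 * m) → z ∈ algebraicClasses B.X m) :
    ∀ (d : ℕ) {X : SchemeOver ℂ} {n : ℕ}, IsSmoothProjective n X → ∀ (A : AbelianVariety ℂ), A.dim = n → (A.X ≅ X) →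
      ∀ {η : complexBetti X 2}, IsPolarizationClass n X η → ∀ {p : ℕ}, 2 ≤ p → 2 * p + d = n →
        ∀ (c : complexBetti X (2 * p)), IsRationalClass c → IsOfHodgeType n X (2 * p) p p c →
          c ∈ primitiveClasses η n (2 * p) → c ∈ algebraicClasses X p := by
  intro d
  induction d with
  | zero =>
    intro X n hX A hA eA η hη p h2 hn c hc hpp hprim
    subst hA
    have hAX : IsSmoothProjective A.dim A.X := AbelianVariety.isSmoothProjective_holds
    -- transport `c`, `η` along `eA : A ≅ X` and apply the hypothesis on `A` itself (`dim A = 2p`)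
    have hz := hpm A p h2 (by omega) (complexBetti.map eA.hom 2 η) (hη.map_of_iso hX hAX eA)
      (complexBetti.map eA.hom (2 * p) c) ((isRationalClass_map_iff_of_iso eA).2 hc)
      ((isOfHodgeType_map_iff_of_iso eA).2 hpp) (map_mem_primitiveClasses eA.hom hprim)
    exact (mem_algebraicClasses_map_iff_of_iso eA).1 hz
  | succ r ih =>
    intro X n hX A hA eA η hη p h2 hn c hc hpp hprim
    -- an elliptic curve `E` with a polarisation class `K_E`; `X × E ≅ (A × E).X`, of dimension `n + 1`
    obtain ⟨E, hE1⟩ := exists_abelianVariety_dim_eq_one ℂ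
    have hE : IsSmoothProjective E.dim E.X := AbelianVariety.isSmoothProjective_holds
    obtain ⟨K_E, hKE⟩ := exists_isPolarizationClass hE
    have hX' : IsSmoothProjective (n + E.dim) (X ⊗ E.X) := IsSmoothProjective.tensor_holds hX hE
    have hA' : (A.prod E).dim = n + E.dim := by rw [AbelianVariety.dim_prod, hA]
    have eA' : (A.prod E).X ≅ X ⊗ E.X := whiskerRightIso eA E.X
    have hη' := isPolarizationClass_boxSum hX hE hη hKE
    -- the b02-lift of `c` is primitive of defect `r`, rational, `(p+1,p+1)` on `X × E`; the induction hypothesis applies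
    have hz := ih hX' (A.prod E) hA' eA' hη' (p := p + 1) (by omega) (by omega) _
      (isRationalClass_primitiveLift E η K_E hη.isRationalClass hKE.isRationalClass hc (r + 1))
      (isOfHodgeType_primitiveLift E η K_E hX hη.mem_algebraicClasses hKE.mem_algebraicClasses hpp (r + 1))
      (primitiveLift_mem_primitiveClasses E η K_E hE1 hn hprim)
    -- descend (slice `X ≅ X × {t}` and Lieberman's `A(X)` for the abelian `X`)
    exact mem_algebraicClasses_of_primitiveLift_mem E η K_E hX hA eA hη hn _ hz

/-! ## §2 `HC_AV` is the Hodge conjecture for primitive middle-degree classes on even-dimensional abelian varieties -/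

/-- **`HC_AV ↔` every rational `(m,m)` Λ-PRIMITIVE class in the MIDDLE degree `H^{2m}` of every complex abelian variety of
dimension `2m ≥ 4`, for EVERY hard Lefschetz datum `Λ`, is algebraic** — NO named fact. `⟸`: part XIV's
`HC_AV_iff_forall_mem_primitiveClasses` asks for Λ-primitive classes of all degrees `2p` (`2 ≤ p ≤ dim A / 2`); §1 with
`d = dim A − 2p` supplies them from the middle ones (a polarisation class `θ` IS `Λ'.hyperplaneClass` for some hard Lefschetz
datum `Λ'`, `IsPolarizationClass.exists_hardLefschetzNFold`). This is the intersection of part XV's two binders (middle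
degree; primitive on even-dimensional). [cite: VoisinHodgeI2002, Thm. 6.25, Cor. 6.26 and Rem. 6.27]
[cite: BrosnanFangNiePearlstein2009, §6 Lemma 48] [cite: KerrPearlstein2011, §3.3 Conj. 41 (setting)] -/
theorem HC_AV_iff_forall_primitiveMiddle :
    HodgeAbelianVarieties ↔
      ∀ (A : AbelianVariety ℂ) (Λ : HardLefschetzNFold A.dim A.X) (m : ℕ), 2 ≤ m → A.dim = 2 * m →
        ∀ c : complexBetti A.X (2 * m), IsRationalClass c → IsOfHodgeType A.dim A.X (2 * m) m m c →
          c ∈ primitiveClasses Λ.hyperplaneClass A.dim (2 * m) → c ∈ algebraicClasses A.X m := by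
  refine ⟨fun h A _ m _ _ c hc hpp _ ↦ (h A).2 m c hc hpp, fun h ↦ HC_AV_iff_forall_mem_primitiveClasses.2 ?_⟩
  intro A Λ p h2 h2p c hc hpp hprim
  have hX : IsSmoothProjective A.dim A.X := AbelianVariety.isSmoothProjective_holds
  refine mem_algebraicClasses_of_mem_primitiveClasses_of_forall_primitiveMiddle ?_ (A.dim - 2 * p) hX A rfl (Iso.refl A.X)
    Λ.isPolarizationClass h2 (by omega) c hc hpp hprim
  intro B m h2m hB θ hθ z hz hzt hzprim
  obtain ⟨Λ', rfl⟩ := hθ.exists_hardLefschetzNFold (AbelianVariety.isSmoothProjective_holds (A := B))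
  exact h B Λ' m h2m hB z hz hzt hzprim

/-- The same with POLARISATION CLASSES `θ` in place of hard Lefschetz data (`θ = Λ.hyperplaneClass` for some `Λ`, and every
`Λ.hyperplaneClass` is a polarisation class), NO named fact. [cite: VoisinHodgeI2002, Thm. 6.25 and Cor. 6.26]
[cite: Kleiman1968AlgebraicCycles, Thm. 2.9] -/
theorem HC_AV_iff_forall_isPolarizationClass_primitiveMiddle :
    HodgeAbelianVarieties ↔
      ∀ (A : AbelianVariety ℂ) (m : ℕ), 2 ≤ m → A.dim = 2 * m →
        ∀ (θ : complexBetti A.X 2), IsPolarizationClass A.dim A.X θ →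
          ∀ c : complexBetti A.X (2 * m), IsRationalClass c → IsOfHodgeType A.dim A.X (2 * m) m m c →
            c ∈ primitiveClasses θ A.dim (2 * m) → c ∈ algebraicClasses A.X m := by
  refine ⟨fun h A m _ _ θ _ c hc hpp _ ↦ (h A).2 m c hc hpp, fun h ↦ HC_AV_iff_forall_primitiveMiddle.2 ?_⟩
  exact fun A Λ m h2 hA c hc hpp hprim ↦ h A m h2 hA Λ.hyperplaneClass Λ.isPolarizationClass c hc hpp hprim

/-- **A counterexample to `HC_AV`, if any, can be taken Lefschetz-PRIMITIVE AND in the MIDDLE degree of an even-dimensional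
abelian variety of dimension `≥ 4`** (for SOME hard Lefschetz datum) — NO named fact.
[cite: VoisinHodgeI2002, Cor. 6.26 and Rem. 6.27] [cite: BrosnanFangNiePearlstein2009, §6 Lemma 48] -/
theorem not_HC_AV_iff_exists_primitiveMiddle_not_mem :
    ¬ HodgeAbelianVarieties ↔
      ∃ (A : AbelianVariety ℂ) (Λ : HardLefschetzNFold A.dim A.X) (m : ℕ), 2 ≤ m ∧ A.dim = 2 * m ∧
        ∃ c : complexBetti A.X (2 * m), IsRationalClass c ∧ IsOfHodgeType A.dim A.X (2 * m) m m c ∧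
          c ∈ primitiveClasses Λ.hyperplaneClass A.dim (2 * m) ∧ c ∉ algebraicClasses A.X m := by
  rw [HC_AV_iff_forall_primitiveMiddle]
  constructor
  · intro h
    by_contra hne
    exact h fun A Λ m h2 hA c hc hpp hprim ↦ by_contra fun hnc ↦ hne ⟨A, Λ, m, h2, hA, c, hc, hpp, hprim, hnc⟩
  · rintro ⟨A, Λ, m, h2, hA, c, hc, hpp, hprim, hnc⟩ h
    exact hnc (h A Λ m h2 hA c hc hpp hprim)

/-! ## §3 The anchored floor read on the primitive-middle binder — a display-only shape, NO node (`HC_CM` enters here) -/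

/-- Display-only shape (NO `def`; census-invisible by design): part XXIV's node `F_CM^mid` with its binder restricted to
Λ-PRIMITIVE classes — every rational `(m,m)` Λ-primitive NON-algebraic class in the middle degree of an abelian variety of
dimension `2m ≥ 4` admits an anchored datum (part VII §A) with a CM fibre at which `W` is NOT algebraic. -/
local notation3 (prettyPrint := false) "F_CM⦃prim,mid⦄" =>
  ∀ (A : AbelianVariety ℂ), IsSmoothProjective (AbelianVariety.dim A) (AbelianVariety.X A) →
    ∀ (Λ : HardLefschetzNFold (AbelianVariety.dim A) (AbelianVariety.X A)) (m : ℕ), 2 ≤ m →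
      AbelianVariety.dim A = 2 * m →
        ∀ (c : complexBetti (AbelianVariety.X A) (2 * m)), IsRationalClass c →
          IsOfHodgeType (AbelianVariety.dim A) (AbelianVariety.X A) (2 * m) m m c →
            c ∈ primitiveClasses (HardLefschetzNFold.hyperplaneClass Λ) (AbelianVariety.dim A) (2 * m) →
              c ∉ algebraicClasses (AbelianVariety.X A) m →
                ∃ (n : ℕ) (𝒳 S : SchemeOver ℂ) (f : 𝒳 ⟶ S) (s : ComplexPoints S) (W : complexBetti 𝒳 (2 * m)),
                  IsCMAnchoredDatumFor A m c f n s W ∧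
                    ∃ s' ∈ cmLocus f n,
                      complexBetti.map (fiberι f s') (2 * m) W ∉ algebraicClasses (fiberOver f s') m

/-- **`F_CM^mid ⟹ F_CM⦃prim,mid⦄`** (from N104), NO fact: forget primitivity. [folklore] -/
theorem primitiveMiddleSpreading_of_middleHodgeFailureSpreadsToCMFibre (h : MiddleHodgeFailureSpreadsToCMFibre) :
    F_CM⦃prim,mid⦄ :=
  fun A hA _ m h2 hm c hc hpp _ hnc ↦ h A hA m h2 hm c hc hpp hnc

/-- `F_CM ⟹ F_CM⦃prim,mid⦄` (from N1), NO fact: through part XXIV's `F_CM ⟹ F_CM^mid`. [folklore] -/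
theorem primitiveMiddleSpreading_of_hodgeFailureSpreadsToCMFibre (h : HodgeFailureSpreadsToCMFibre) : F_CM⦃prim,mid⦄ :=
  primitiveMiddleSpreading_of_middleHodgeFailureSpreadsToCMFibre
    (middleHodgeFailureSpreadsToCMFibre_of_hodgeFailureSpreadsToCMFibre h)

/-- `F_CM^prim ⟹ F_CM⦃prim,mid⦄` (from N102), NO fact: restrict part XIV's node to `p = m = dim A / 2`. [folklore] -/
theorem primitiveMiddleSpreading_of_primitiveHodgeFailureSpreadsToCMFibre (h : PrimitiveHodgeFailureSpreadsToCMFibre) :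
    F_CM⦃prim,mid⦄ :=
  fun A hA Λ m h2 hm c hc hpp hprim hnc ↦ h A hA Λ m h2 (by omega) c hc hpp hprim hnc

/-- `F_CM^{prim,ev} ⟹ F_CM⦃prim,mid⦄` (from N103), NO fact: through part XXIV. [folklore] -/
theorem primitiveMiddleSpreading_of_evenPrimitiveHodgeFailureSpreadsToCMFibre
    (h : EvenPrimitiveHodgeFailureSpreadsToCMFibre) : F_CM⦃prim,mid⦄ :=
  primitiveMiddleSpreading_of_middleHodgeFailureSpreadsToCMFibre
    (middleHodgeFailureSpreadsToCMFibre_of_evenPrimitiveHodgeFailureSpreadsToCMFibre h)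

/-- **CLOSING: `HC_CM → F_CM⦃prim,mid⦄ → HC_AV`**, NO named fact — the brief's two-hypothesis shape read on the smallest
binder. By §2 it suffices to treat a rational `(m,m)` Λ-primitive middle-degree class on an abelian variety of dimension
`2m ≥ 4`; were it not algebraic, the premise gives an anchored datum and a CM fibre where `W` is NOT algebraic, while `HC_CM`
makes `W` algebraic at every CM fibre (part VII) — contradiction. [cite: Deligne1982HodgeCycles, §6 proof of Thm. 2.11
(pp. 71–73)] [cite: Milne1999, §7 p. 72 (hypothesis (H))] [cite: BrosnanFangNiePearlstein2009, §6 Lemma 48] -/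
theorem HC_AV_of_HC_CM_of_primitiveMiddleSpreading (hCM : CMAbelianHodge) (h : F_CM⦃prim,mid⦄) :
    HodgeAbelianVarieties := by
  refine HC_AV_iff_forall_primitiveMiddle.2 fun A Λ m h2 hA c hc hpp hprim ↦ ?_
  by_contra hnc
  obtain ⟨n, 𝒳, S, f, s, W, hd, s', hs', hns'⟩ :=
    h A (AbelianVariety.isSmoothProjective_holds (A := A)) Λ m h2 hA c hc hpp hprim hnc
  exact hns' (forall_cmLocus_mem_algebraicClasses_of_HC_CM_of_isCMAnchoredDatumFor hCM hd s' hs')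

/-- `F_CM⦃prim,mid⦄` closes with `HC_CM`, NO fact (LEAD grammar). [folklore] -/
theorem closesWithCM_primitiveMiddleSpreading : ClosesWithCM (F_CM⦃prim,mid⦄) :=
  fun hCM h ↦ HC_AV_of_HC_CM_of_primitiveMiddleSpreading hCM h

/-- Hence `F_CM⦃prim,mid⦄ ⟹ CMToAbelian` outright (a typed conditional TOWARD stmt-HodgeConjecture-16267, which stays OPEN).
[folklore] -/
theorem cmToAbelian_of_primitiveMiddleSpreading : F_CM⦃prim,mid⦄ → CMToAbelian :=
  cmToAbelian_of_closesWithCM closesWithCM_primitiveMiddleSpreading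

/-- ON-PATH, NO fact: `HC_AV ⟹ F_CM⦃prim,mid⦄` (nothing triggers it). [folklore] -/
theorem onPathAV_primitiveMiddleSpreading : OnPathAV (F_CM⦃prim,mid⦄) :=
  fun hAV A _ _ m _ _ c hc hpp _ hnc ↦ absurd ((hAV A).2 m c hc hpp) hnc

/-- EXACTNESS, NO named fact: `HC_AV ↔ (HC_CM ∧ F_CM⦃prim,mid⦄)`. [folklore] -/
theorem exactWithCM_primitiveMiddleSpreading : ExactWithCM (F_CM⦃prim,mid⦄) :=
  exactWithCM_iff.2 ⟨closesWithCM_primitiveMiddleSpreading, onPathAV_primitiveMiddleSpreading⟩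

/-- The same, unfolded: `HC_AV ↔ (HC_CM ∧ F_CM⦃prim,mid⦄)`, NO named fact. [folklore] -/
theorem HC_AV_iff_HC_CM_and_primitiveMiddleSpreading :
    HodgeAbelianVarieties ↔ (CMAbelianHodge ∧ F_CM⦃prim,mid⦄) :=
  exactWithCM_primitiveMiddleSpreading

/-- Relativised to `HC_CM` the shape IS the item: `ModCM F_CM⦃prim,mid⦄ ↔ CMToAbelian`, NO named fact. [folklore] -/
theorem modCM_primitiveMiddleSpreading_iff_cmToAbelian : ModCM (F_CM⦃prim,mid⦄) ↔ CMToAbelian :=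
  modCM_iff_cmToAbelian_of_exactWithCM exactWithCM_primitiveMiddleSpreading

/-- Under `HC_CM` alone (no print): `F_CM⦃prim,mid⦄ ↔ HC_AV`. [folklore] -/
theorem primitiveMiddleSpreading_iff_HC_AV_of_HC_CM (hCM : CMAbelianHodge) :
    F_CM⦃prim,mid⦄ ↔ HodgeAbelianVarieties :=
  iff_HC_AV_of_exactWithCM_of_HC_CM exactWithCM_primitiveMiddleSpreading hCM

/-- COLLAPSE under `HC_CM` alone (no print): `F_CM⦃prim,mid⦄ ↔ F_CM^mid`; the `HC_CM`-free converse
`F_CM⦃prim,mid⦄ → F_CM^mid` is OPEN and NOT claimed. [folklore] -/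
theorem primitiveMiddleSpreading_iff_middle_of_HC_CM (hCM : CMAbelianHodge) :
    F_CM⦃prim,mid⦄ ↔ MiddleHodgeFailureSpreadsToCMFibre :=
  (primitiveMiddleSpreading_iff_HC_AV_of_HC_CM hCM).trans (middleHodgeFailureSpreadsToCMFibre_iff_HC_AV_of_HC_CM hCM).symm

/-- ON-PATH from the summit, NO fact. [folklore] -/
theorem primitiveMiddleSpreading_of_hodgeConjecture (hHC : _root_.HodgeConjecture) : F_CM⦃prim,mid⦄ :=
  primitiveMiddleSpreading_of_middleHodgeFailureSpreadsToCMFibre (middleHodgeFailureSpreadsToCMFibre_of_hodgeConjecture hHC)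

/-! ## §4 Modulo print (`hF ∧ h83` displayed): the primitive-middle reading adds nothing either -/

/-- **`F_CM⦃prim,mid⦄ ↔ CMToAbelian`**, MOD `hF ∧ h83` (both displayed), NO `HC_CM` binder: part XXVII's deflation read on the
smallest binder. [cite: Deligne1982HodgeCycles, Prop. 6.1 (a)(b) (p. 71)] [cite: Hazama2003GHCCM, Thm. 8.3 p. 655] -/
theorem primitiveMiddleSpreading_iff_cmToAbelian_of_hazama2003_of_deligne1982
    (hF : deligne1982_cmDenseMumfordTateFamilies) (h83 : Hazama2003_generalHodge_cmType_of_hodge_codimTwo) :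
    F_CM⦃prim,mid⦄ ↔ CMToAbelian :=
  ⟨cmToAbelian_of_primitiveMiddleSpreading, fun h ↦ primitiveMiddleSpreading_of_middleHodgeFailureSpreadsToCMFibre
    ((middleHodgeFailureSpreadsToCMFibre_iff_cmToAbelian_of_hazama2003_of_deligne1982 hF h83).2 h)⟩

/-- **`F_CM⦃prim,mid⦄ ↔ F_CM^mid`**, MOD `hF ∧ h83` (both displayed): the open `HC_CM`-free converse holds modulo the two
records. [cite: Deligne1982HodgeCycles, Prop. 6.1 (a)(b) (p. 71)] [cite: Hazama2003GHCCM, Thm. 8.3 p. 655] -/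
theorem primitiveMiddleSpreading_iff_middle_of_hazama2003_of_deligne1982
    (hF : deligne1982_cmDenseMumfordTateFamilies) (h83 : Hazama2003_generalHodge_cmType_of_hodge_codimTwo) :
    F_CM⦃prim,mid⦄ ↔ MiddleHodgeFailureSpreadsToCMFibre :=
  (primitiveMiddleSpreading_iff_cmToAbelian_of_hazama2003_of_deligne1982 hF h83).trans
    (middleHodgeFailureSpreadsToCMFibre_iff_cmToAbelian_of_hazama2003_of_deligne1982 hF h83).symm

/-! ## §5 Summary row (fact-free) -/

/-- **THE PRIMITIVE-MIDDLE READING IN ONE ROW**, NO named fact: `F_CM → F_CM^mid → F_CM⦃prim,mid⦄ → CMToAbelian` and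
`HC_AV ↔ HC_CM ∧ F_CM⦃prim,mid⦄`; nothing here is "minimal". [folklore] -/
theorem spreadFloor_primitiveMiddle_reading :
    (HodgeFailureSpreadsToCMFibre → MiddleHodgeFailureSpreadsToCMFibre) ∧
      (MiddleHodgeFailureSpreadsToCMFibre → F_CM⦃prim,mid⦄) ∧ (F_CM⦃prim,mid⦄ → CMToAbelian) ∧
        (HodgeAbelianVarieties ↔ (CMAbelianHodge ∧ F_CM⦃prim,mid⦄)) :=
  ⟨middleHodgeFailureSpreadsToCMFibre_of_hodgeFailureSpreadsToCMFibre,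
    primitiveMiddleSpreading_of_middleHodgeFailureSpreadsToCMFibre, cmToAbelian_of_primitiveMiddleSpreading,
    HC_AV_iff_HC_CM_and_primitiveMiddleSpreading⟩

/-! ## Audit (kernel-checked): the closures are EXACTLY the three standard axioms — fact-free core §§1–3, §5; in §4 the two
records `hF`, `h83` are hypotheses, not axioms; `HC_CM` is only ever a binder -/

/-- info: 'Summit.HodgeConjecture.HodgeConjecture.Ring2.AbelianAll.mem_algebraicClasses_of_mem_primitiveClasses_of_forall_primitiveMiddle' depends on axioms: [propext, Classical.choice, Quot.sound] -/
#guard_msgs (whitespace := lax) in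
#print axioms mem_algebraicClasses_of_mem_primitiveClasses_of_forall_primitiveMiddle
/-- info: 'Summit.HodgeConjecture.HodgeConjecture.Ring2.AbelianAll.HC_AV_iff_forall_primitiveMiddle' depends on axioms: [propext, Classical.choice, Quot.sound] -/
#guard_msgs (whitespace := lax) in
#print axioms HC_AV_iff_forall_primitiveMiddle
/-- info: 'Summit.HodgeConjecture.HodgeConjecture.Ring2.AbelianAll.not_HC_AV_iff_exists_primitiveMiddle_not_mem' depends on axioms: [propext, Classical.choice, Quot.sound] -/
#guard_msgs (whitespace := lax) in
#print axioms not_HC_AV_iff_exists_primitiveMiddle_not_mem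
/-- info: 'Summit.HodgeConjecture.HodgeConjecture.Ring2.AbelianAll.HC_AV_iff_HC_CM_and_primitiveMiddleSpreading' depends on axioms: [propext, Classical.choice, Quot.sound] -/
#guard_msgs (whitespace := lax) in
#print axioms HC_AV_iff_HC_CM_and_primitiveMiddleSpreading
/-- info: 'Summit.HodgeConjecture.HodgeConjecture.Ring2.AbelianAll.primitiveMiddleSpreading_iff_cmToAbelian_of_hazama2003_of_deligne1982' depends on axioms: [propext, Classical.choice, Quot.sound] -/
#guard_msgs (whitespace := lax) in
#print axioms primitiveMiddleSpreading_iff_cmToAbelian_of_hazama2003_of_deligne1982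

end Summit.HodgeConjecture.HodgeConjecture.Ring2.AbelianAll
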